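import Summits.ValiantsHypothesis.ValiantsHypothesis.Theorems.BarrierLeverChowCubeThetaHat

/-!
# Route BarrierLever — items 20195 / 20172: the PEELING CALCULUS for `det Θ̂ ≠ 0`
# (x-private design on down-closed columns), I: entries under a coordinate specialisation,
# the size-`≤ 1` base, and the balanced peeling step

Helper file (`--supports stmt-ValiantsHypothesis-20195`; cell valiant-natproofs, rung V4, 𝒟-side of
door (c); seat val-np-p2 gen 8).  Closes NO item; definition-free.  Continues `…ChowCubeThetaHat`:
`Θ̂_q[U, S] = coeff (E ∅ S) ∏_{a ∈ U} t_a(q)` for a coefficient table `q : Fin h → Fin h → R`.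

* `thetaHat_insert` (convolution), `thetaHat_congr` (`Θ̂_q[U,S]` depends only on `q` on `U × S`),
  `thetaHat_eq_zero_of_col` (if `q a c = 0` for all `a ∈ U` then `Θ̂_q[U, S] = 0` for `S ∋ c`),
  `thetaHat_row_mem` (if moreover `q c c' = 0` for `c' ≠ c` then for `U ∋ c`:
  `Θ̂_q[U, S] = -q c c · Θ̂_q[U - c, S - c]` if `c ∈ S`, `= Θ̂_q[U - c, S]` if `c ∉ S`),
  `map_thetaHat` (ring homomorphisms act on `Θ̂` through `q`).
* PEELING A COORDINATE `c` = the substitution `q a c ↦ 0 (a ≠ c)`, `q c c' ↦ 0 (c' ≠ c)` in the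
  generic table `q a c = X (a, c)` over `R₀ = MvPolynomial (Fin h × Fin h) ℂ`: the matrix
  `Θ̂[u, δ]` becomes block triangular — rows/columns containing `c` against the rest — with blocks
  `Θ̂[u|_{c∉}, δ|_{c∉}]` and `-X(c,c) · Θ̂[u - c, δ - c]`.  Hence (`det_thetaHat_ne_zero_of_peel`,
  rule (P1)): if `#{i : c ∈ u i} = #{j : c ∈ δ j}` (a bijection is supplied) and both the restricted
  layout `(u, δ)|_{c ∉}` and the erased layout `((u i - c)_{c ∈ u i}, (δ j - c)_{c ∈ δ j})` have
  `det Θ̂ ≠ 0`, then `det Θ̂[u, δ] ≠ 0`.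
* BASE (`det_thetaHat_ne_zero_of_card_le_one`, rule (V)): rows of size `≤ 1` (injective; if `∅` is
  a row then `∅` is a column) against any injective column family: `det Θ̂ ≠ 0` (evaluation at a
  `0/1` table makes the matrix containment-triangular, `det_of_subsetTriangular`).
The erased layout of (P1) always has rows of size `≤ 1`, so (V) discharges it; iterating (P1) peels
a layout coordinate by coordinate.  With `…ChowCubeThetaHat.det_xPrivate_eq_det_thetaHat` and the
cube reduction this certifies, e.g., every FULL thin row family against every column family whose
compression is `{∅, singletons, pairs}` (next file), and — seat census `num/grclass2.py`, exact —
97 % of random thin layouts at `h = 5` for some compression order (all of the dense regime `r = N`).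

WHAT THIS IS NOT: a certificate calculus; items 20195 / 20172 / 19717 stay open; nothing on crux
stmt-ValiantsHypothesis-14610 or on `VP` versus `VNP`.
-/

set_option linter.dupNamespace false

namespace Summit.ValiantsHypothesis.ValiantsHypothesis.Theorems.BarrierLever.ChowCube

open Finset MvPolynomial
open Summit.ValiantsHypothesis.ValiantsHypothesis.Theorems.BarrierLever.ChowFactor
  (coeff_partitionExpo_mul_yOnly support_castAdd_eq_zero_of_vars castAdd_notMem_vars_prod)
open Summit.ValiantsHypothesis.ValiantsHypothesis.Theorems.BarrierLever.CorankRepair (partitionExpo_eq_iff)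

variable {R : Type*} [CommRing R] {h : ℕ}

/-! ## 1. Entries of `Θ̂` -/

/-- **Convolution**: `Θ̂_q[insert a₀ U, S] = Σ_{d ⊆ S} Θ̂_q[U, S ∖ d] · (-1)^{|d|} |d|! ∏_{c∈d} q a₀ c`
(`a₀ ∉ U`). -/
theorem thetaHat_insert (q : Fin h → Fin h → R) (a₀ : Fin h) (U S : Finset (Fin h)) (ha₀ : a₀ ∉ U) :
    coeff (∑ a ∈ (∅ : Finset (Fin h)), Finsupp.single (Fin.castAdd h a) 1 +
        ∑ c ∈ S, Finsupp.single (Fin.natAdd h c) 1)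
      (∏ a ∈ insert a₀ U, ∑ S' ∈ (Finset.univ : Finset (Fin h)).powerset,
        monomial (∑ a' ∈ (∅ : Finset (Fin h)), Finsupp.single (Fin.castAdd h a') 1 +
          ∑ c ∈ S', Finsupp.single (Fin.natAdd h c) 1)
          ((-1 : R) ^ S'.card * (S'.card.factorial : R) * ∏ c ∈ S', q a c) :
            MvPolynomial (Fin (h + h)) R) =
      ∑ d ∈ S.powerset, coeff (∑ a ∈ (∅ : Finset (Fin h)), Finsupp.single (Fin.castAdd h a) 1 +
          ∑ c ∈ S \ d, Finsupp.single (Fin.natAdd h c) 1)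
        (∏ a ∈ U, ∑ S' ∈ (Finset.univ : Finset (Fin h)).powerset,
          monomial (∑ a' ∈ (∅ : Finset (Fin h)), Finsupp.single (Fin.castAdd h a') 1 +
            ∑ c ∈ S', Finsupp.single (Fin.natAdd h c) 1)
            ((-1 : R) ^ S'.card * (S'.card.factorial : R) * ∏ c ∈ S', q a c) :
              MvPolynomial (Fin (h + h)) R) *
        ((-1 : R) ^ d.card * (d.card.factorial : R) * ∏ c ∈ d, q a₀ c) := by
  classical
  rw [Finset.prod_insert ha₀, mul_comm, coeff_partitionExpo_mul_yOnly _ _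
    (support_castAdd_eq_zero_of_vars _ (castAdd_notMem_vars_tinv (q a₀))) ∅ S]
  simp_rw [coeff_tinv]

/-- **`Θ̂_q[U, S]` depends only on the values `q a c`, `a ∈ U`, `c ∈ S`.** -/
theorem thetaHat_congr (q q₂ : Fin h → Fin h → R) (U S : Finset (Fin h))
    (hq : ∀ a ∈ U, ∀ c ∈ S, q a c = q₂ a c) :
    coeff (∑ a ∈ (∅ : Finset (Fin h)), Finsupp.single (Fin.castAdd h a) 1 +
        ∑ c ∈ S, Finsupp.single (Fin.natAdd h c) 1)
      (∏ a ∈ U, ∑ S' ∈ (Finset.univ : Finset (Fin h)).powerset,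
        monomial (∑ a' ∈ (∅ : Finset (Fin h)), Finsupp.single (Fin.castAdd h a') 1 +
          ∑ c ∈ S', Finsupp.single (Fin.natAdd h c) 1)
          ((-1 : R) ^ S'.card * (S'.card.factorial : R) * ∏ c ∈ S', q a c) :
            MvPolynomial (Fin (h + h)) R) =
      coeff (∑ a ∈ (∅ : Finset (Fin h)), Finsupp.single (Fin.castAdd h a) 1 +
        ∑ c ∈ S, Finsupp.single (Fin.natAdd h c) 1)
      (∏ a ∈ U, ∑ S' ∈ (Finset.univ : Finset (Fin h)).powerset,
        monomial (∑ a' ∈ (∅ : Finset (Fin h)), Finsupp.single (Fin.castAdd h a') 1 +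
          ∑ c ∈ S', Finsupp.single (Fin.natAdd h c) 1)
          ((-1 : R) ^ S'.card * (S'.card.factorial : R) * ∏ c ∈ S', q₂ a c) :
            MvPolynomial (Fin (h + h)) R) := by
  classical
  induction U using Finset.induction_on generalizing S with
  | empty => rw [Finset.prod_empty, Finset.prod_empty]
  | insert a₀ U ha₀ ih =>
    rw [thetaHat_insert q a₀ U S ha₀, thetaHat_insert q₂ a₀ U S ha₀]
    refine Finset.sum_congr rfl fun d hd => ?_
    have hdS : d ⊆ S := Finset.mem_powerset.mp hd
    rw [ih (S \ d) (fun a ha c hc => hq a (Finset.mem_insert_of_mem ha) c (Finset.sdiff_subset hc)),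
      Finset.prod_congr rfl fun c hc => hq a₀ (Finset.mem_insert_self a₀ U) c (hdS hc)]

/-- **Zero pattern after peeling, I.**  If `q a c = 0` for every `a ∈ U`, then `Θ̂_q[U, S] = 0` for
every `S ∋ c` (no factor `t_a`, `a ∈ U`, involves `y_c`). -/
theorem thetaHat_eq_zero_of_col (q : Fin h → Fin h → R) (c : Fin h) (U S : Finset (Fin h))
    (hq : ∀ a ∈ U, q a c = 0) (hc : c ∈ S) :
    coeff (∑ a ∈ (∅ : Finset (Fin h)), Finsupp.single (Fin.castAdd h a) 1 +
        ∑ c ∈ S, Finsupp.single (Fin.natAdd h c) 1)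
      (∏ a ∈ U, ∑ S' ∈ (Finset.univ : Finset (Fin h)).powerset,
        monomial (∑ a' ∈ (∅ : Finset (Fin h)), Finsupp.single (Fin.castAdd h a') 1 +
          ∑ c ∈ S', Finsupp.single (Fin.natAdd h c) 1)
          ((-1 : R) ^ S'.card * (S'.card.factorial : R) * ∏ c ∈ S', q a c) :
            MvPolynomial (Fin (h + h)) R) = 0 := by
  classical
  induction U using Finset.induction_on generalizing S with
  | empty =>
    rw [Finset.prod_empty, ← C_1, coeff_C, if_neg]
    intro e
    have e' := ((partitionExpo_eq_iff ∅ ∅ ∅ S).mp (by rw [← e]; simp)).2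
    rw [← e'] at hc
    exact Finset.notMem_empty c hc
  | insert a₀ U ha₀ ih =>
    rw [thetaHat_insert q a₀ U S ha₀]
    refine Finset.sum_eq_zero fun d hd => ?_
    by_cases hcd : c ∈ d
    · rw [← Finset.prod_erase_mul d (fun c' => q a₀ c') hcd, hq a₀ (Finset.mem_insert_self a₀ U)]
      simp
    · rw [ih (S \ d) (fun a ha => hq a (Finset.mem_insert_of_mem ha)) (Finset.mem_sdiff.mpr ⟨hc, hcd⟩),
        zero_mul]

/-- **Zero pattern after peeling, II (rows through `c`).**  If `c ∈ U`, `q a c = 0` for the other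
`a ∈ U` and `q c c' = 0` for `c' ≠ c`, then
`Θ̂_q[U, S] = -q c c · Θ̂_q[U - c, S - c]` when `c ∈ S`, and `Θ̂_q[U, S] = Θ̂_q[U - c, S]` when `c ∉ S`. -/
theorem thetaHat_row_mem (q : Fin h → Fin h → R) (c : Fin h) (U S : Finset (Fin h)) (hcU : c ∈ U)
    (hq₁ : ∀ a ∈ U, a ≠ c → q a c = 0) (hq₂ : ∀ c', c' ≠ c → q c c' = 0) :
    coeff (∑ a ∈ (∅ : Finset (Fin h)), Finsupp.single (Fin.castAdd h a) 1 +
        ∑ c ∈ S, Finsupp.single (Fin.natAdd h c) 1)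
      (∏ a ∈ U, ∑ S' ∈ (Finset.univ : Finset (Fin h)).powerset,
        monomial (∑ a' ∈ (∅ : Finset (Fin h)), Finsupp.single (Fin.castAdd h a') 1 +
          ∑ c ∈ S', Finsupp.single (Fin.natAdd h c) 1)
          ((-1 : R) ^ S'.card * (S'.card.factorial : R) * ∏ c ∈ S', q a c) :
            MvPolynomial (Fin (h + h)) R) =
      if c ∈ S then -q c c * coeff (∑ a ∈ (∅ : Finset (Fin h)), Finsupp.single (Fin.castAdd h a) 1 +
          ∑ c' ∈ S.erase c, Finsupp.single (Fin.natAdd h c') 1)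
        (∏ a ∈ U.erase c, ∑ S' ∈ (Finset.univ : Finset (Fin h)).powerset,
          monomial (∑ a' ∈ (∅ : Finset (Fin h)), Finsupp.single (Fin.castAdd h a') 1 +
            ∑ c ∈ S', Finsupp.single (Fin.natAdd h c) 1)
            ((-1 : R) ^ S'.card * (S'.card.factorial : R) * ∏ c ∈ S', q a c) :
              MvPolynomial (Fin (h + h)) R)
      else coeff (∑ a ∈ (∅ : Finset (Fin h)), Finsupp.single (Fin.castAdd h a) 1 +
          ∑ c' ∈ S, Finsupp.single (Fin.natAdd h c') 1)
        (∏ a ∈ U.erase c, ∑ S' ∈ (Finset.univ : Finset (Fin h)).powerset,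
          monomial (∑ a' ∈ (∅ : Finset (Fin h)), Finsupp.single (Fin.castAdd h a') 1 +
            ∑ c ∈ S', Finsupp.single (Fin.natAdd h c) 1)
            ((-1 : R) ^ S'.card * (S'.card.factorial : R) * ∏ c ∈ S', q a c) :
              MvPolynomial (Fin (h + h)) R) := by
  classical
  rw [← Finset.insert_erase hcU, thetaHat_insert q c (U.erase c) S (Finset.notMem_erase c U),
    Finset.insert_erase hcU]
  -- only `d = ∅` and `d = {c}` contribute: `∏_{c'∈d} q c c' = 0` unless `d ⊆ {c}`
  have hvan : ∀ d ∈ S.powerset, d ≠ ∅ → d ≠ {c} →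
      coeff (∑ a ∈ (∅ : Finset (Fin h)), Finsupp.single (Fin.castAdd h a) 1 +
          ∑ c ∈ S \ d, Finsupp.single (Fin.natAdd h c) 1)
        (∏ a ∈ U.erase c, ∑ S' ∈ (Finset.univ : Finset (Fin h)).powerset,
          monomial (∑ a' ∈ (∅ : Finset (Fin h)), Finsupp.single (Fin.castAdd h a') 1 +
            ∑ c ∈ S', Finsupp.single (Fin.natAdd h c) 1)
            ((-1 : R) ^ S'.card * (S'.card.factorial : R) * ∏ c ∈ S', q a c) :
              MvPolynomial (Fin (h + h)) R) *
        ((-1 : R) ^ d.card * (d.card.factorial : R) * ∏ c' ∈ d, q c c') = 0 := by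
    intro d _ hd0 hdc
    obtain ⟨c', hc'd, hc'c⟩ : ∃ c' ∈ d, c' ≠ c := by
      by_contra hall
      push Not at hall
      rcases Finset.eq_empty_or_nonempty d with e | ⟨x, hx⟩
      · exact hd0 e
      · apply hdc
        ext y
        rw [Finset.mem_singleton]
        exact ⟨fun hy => hall y hy, fun hy => by rw [hy, ← hall x hx]; exact hx⟩
    rw [← Finset.prod_erase_mul d (fun c'' => q c c'') hc'd, hq₂ c' hc'c]
    simp
  by_cases hcS : c ∈ S
  · rw [if_pos hcS]
    rw [Finset.sum_eq_add_of_mem (∅ : Finset (Fin h)) ({c} : Finset (Fin h))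
      (Finset.mem_powerset.mpr (Finset.empty_subset S))
      (Finset.mem_powerset.mpr (Finset.singleton_subset_iff.mpr hcS))
      (Finset.empty_ne_singleton c).symm.symm (fun d hd hne => hvan d hd hne.1 hne.2)]
    rw [Finset.sdiff_empty, thetaHat_eq_zero_of_col q c (U.erase c) S
      (fun a ha => hq₁ a (Finset.mem_of_mem_erase ha) (Finset.ne_of_mem_erase ha)) hcS, zero_mul,
      zero_add, Finset.card_singleton, Finset.prod_singleton, Finset.sdiff_singleton_eq_erase]
    simp only [pow_one, Nat.factorial_one, Nat.cast_one, mul_one]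
    ring
  · rw [if_neg hcS]
    rw [Finset.sum_eq_single_of_mem (∅ : Finset (Fin h))
      (Finset.mem_powerset.mpr (Finset.empty_subset S)) (fun d hd hne => ?_)]
    · rw [Finset.sdiff_empty]
      simp
    · refine hvan d hd hne fun e => hcS ?_
      rw [e] at hd
      exact Finset.singleton_subset_iff.mp (Finset.mem_powerset.mp hd)

/-- **Ring homomorphisms act on `Θ̂` through the table**: `f (Θ̂_q[U,S]) = Θ̂_{f ∘ q}[U,S]`. -/
theorem map_thetaHat {R' : Type*} [CommRing R'] (f : R →+* R') (q : Fin h → Fin h → R)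
    (U S : Finset (Fin h)) :
    f (coeff (∑ a ∈ (∅ : Finset (Fin h)), Finsupp.single (Fin.castAdd h a) 1 +
        ∑ c ∈ S, Finsupp.single (Fin.natAdd h c) 1)
      (∏ a ∈ U, ∑ S' ∈ (Finset.univ : Finset (Fin h)).powerset,
        monomial (∑ a' ∈ (∅ : Finset (Fin h)), Finsupp.single (Fin.castAdd h a') 1 +
          ∑ c ∈ S', Finsupp.single (Fin.natAdd h c) 1)
          ((-1 : R) ^ S'.card * (S'.card.factorial : R) * ∏ c ∈ S', q a c) :
            MvPolynomial (Fin (h + h)) R)) =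
      coeff (∑ a ∈ (∅ : Finset (Fin h)), Finsupp.single (Fin.castAdd h a) 1 +
        ∑ c ∈ S, Finsupp.single (Fin.natAdd h c) 1)
      (∏ a ∈ U, ∑ S' ∈ (Finset.univ : Finset (Fin h)).powerset,
        monomial (∑ a' ∈ (∅ : Finset (Fin h)), Finsupp.single (Fin.castAdd h a') 1 +
          ∑ c ∈ S', Finsupp.single (Fin.natAdd h c) 1)
          ((-1 : R') ^ S'.card * (S'.card.factorial : R') * ∏ c ∈ S', f (q a c)) :
            MvPolynomial (Fin (h + h)) R') := by
  classical
  rw [← coeff_map, map_prod]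
  congr 1
  refine Finset.prod_congr rfl fun a _ => ?_
  rw [map_sum]
  refine Finset.sum_congr rfl fun S' _ => ?_
  rw [map_monomial]
  congr 1
  rw [map_mul, map_mul, map_pow, map_neg, map_one, map_natCast, map_prod]


/-! ## 2. Containment-triangular matrices -/

/-- **Containment-triangular determinants.**  If `δ` is injective and `M i j ≠ 0` only when
`δ j ⊆ δ i`, then `det M = ∏ i, M i i` (order the indices by a linear extension of containment). -/
theorem det_of_subsetTriangular {ι : Type*} [Fintype ι] [DecidableEq ι] (δ : ι → Finset (Fin h))
    (hδ : Function.Injective δ) (M : Matrix ι ι R) (hM : ∀ i j, M i j ≠ 0 → δ j ⊆ δ i) :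
    M.det = ∏ i, M i i := by
  classical
  -- a linear order on `ι` refining strict containment of `δ`
  let enc : ι → ℕ := fun i => (Fintype.equivFin ι i : ℕ)
  let f : ι → ℕ ×ₗ ℕ := fun i => toLex ((δ i).card, enc i)
  have hf : Function.Injective f := by
    intro i j e
    have e2 := (Prod.ext_iff.mp (toLex.injective e)).2
    exact (Fintype.equivFin ι).injective (Fin.ext e2)
  letI : LinearOrder ι := LinearOrder.lift' f hf
  refine Matrix.det_of_lowerTriangular M fun i j hij => ?_
  -- `hij : toDual j < toDual i`, i.e. `i < j`
  have hij' : i < j := hij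
  by_contra hne
  have hsub := hM i j hne
  have hle : f j ≤ f i := by
    rcases eq_or_ne j i with e | hne'
    · rw [e]
    · have hlt : (δ j).card < (δ i).card :=
        Finset.card_lt_card (lt_of_le_of_ne hsub fun e => hne' (hδ e))
      exact le_of_lt (Prod.Lex.toLex_lt_toLex.mpr (Or.inl hlt))
  exact absurd hij' (not_lt.mpr hle)

/-! ## 3. Base rule (V): rows of size `≤ 1` -/

/-- **Rule (V).**  In the generic table `q a c = X (a, c)` over `MvPolynomial (Fin h × Fin h) ℂ`:
for injective rows `u` of size `≤ 1` and injective columns `δ` such that `∅` is a column whenever it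
is a row, `det Θ̂[u, δ] ≠ 0`.  (Evaluate `X (a, c) ↦ [c ∈ δ (τ i)]` for the row `u i = {a}`, with `τ` a
bijection rows → columns sending the empty row to the empty column: the matrix becomes
`[δ j ⊆ δ (τ i)] · (-1)^{|δ j|} |δ j|!`, containment-triangular.) -/
theorem det_thetaHat_ne_zero_of_card_le_one {ι : Type*} [Fintype ι] [DecidableEq ι]
    (Θ : Finset (Fin h) → Finset (Fin h) → MvPolynomial (Fin h × Fin h) ℂ)
    (hΘ : ∀ U S, Θ U S = coeff (∑ a ∈ (∅ : Finset (Fin h)), Finsupp.single (Fin.castAdd h a) 1 +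
        ∑ c ∈ S, Finsupp.single (Fin.natAdd h c) 1)
      (∏ a ∈ U, ∑ S' ∈ (Finset.univ : Finset (Fin h)).powerset,
        monomial (∑ a' ∈ (∅ : Finset (Fin h)), Finsupp.single (Fin.castAdd h a') 1 +
          ∑ c ∈ S', Finsupp.single (Fin.natAdd h c) 1)
          ((-1 : MvPolynomial (Fin h × Fin h) ℂ) ^ S'.card *
            (S'.card.factorial : MvPolynomial (Fin h × Fin h) ℂ) * ∏ c ∈ S', X (a, c)) :
            MvPolynomial (Fin (h + h)) (MvPolynomial (Fin h × Fin h) ℂ)))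
    (u δ : ι → Finset (Fin h)) (hu : Function.Injective u) (hδ : Function.Injective δ)
    (hcard : ∀ i, (u i).card ≤ 1) (hempty : ∀ i, u i = ∅ → ∃ j, δ j = ∅) :
    (Matrix.of fun i j => Θ (u i) (δ j)).det ≠ 0 := by
  classical
  -- the bijection rows → columns
  obtain ⟨τ, hτ⟩ : ∃ τ : Equiv.Perm ι, ∀ i, u i = ∅ → δ (τ i) = ∅ := by
    by_cases h0 : ∃ i, u i = ∅
    · obtain ⟨i₀, hi₀⟩ := h0
      obtain ⟨j₀, hj₀⟩ := hempty i₀ hi₀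
      refine ⟨Equiv.swap i₀ j₀, fun i hi => ?_⟩
      have e : i = i₀ := hu (hi.trans hi₀.symm)
      rw [e, Equiv.swap_apply_left, hj₀]
    · exact ⟨Equiv.refl ι, fun i hi => absurd ⟨i, hi⟩ h0⟩
  -- the evaluation point
  set x : Fin h × Fin h → ℂ := fun p => if ∃ i, u i = {p.1} ∧ p.2 ∈ δ (τ i) then 1 else 0 with hx
  intro hdet
  have hev := congr_arg (MvPolynomial.eval x) hdet
  rw [map_zero, RingHom.map_det] at hev
  -- the evaluated entries
  have hentry : ∀ i j, MvPolynomial.eval x (Θ (u i) (δ j)) =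
      if δ j ⊆ δ (τ i) then (-1 : ℂ) ^ (δ j).card * ((δ j).card.factorial : ℂ) else 0 := by
    intro i j
    rw [hΘ, map_thetaHat]
    simp only [eval_X]
    rcases Nat.le_one_iff_eq_zero_or_eq_one.mp (hcard i) with h0 | h1
    · have hui : u i = ∅ := Finset.card_eq_zero.mp h0
      rw [hui, thetaHat_empty_row, hτ i hui]
      by_cases hj : δ j = ∅
      · rw [if_pos hj, if_pos (by rw [hj]), hj]
        simp
      · rw [if_neg hj, if_neg (fun hsub => hj (Finset.subset_empty.mp hsub))]
    · obtain ⟨a, ha⟩ := Finset.card_eq_one.mp h1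
      rw [ha, thetaHat_singleton_row]
      have hxa : ∀ c, x (a, c) = if c ∈ δ (τ i) then 1 else 0 := by
        intro c
        rw [hx]
        simp only
        by_cases hc : c ∈ δ (τ i)
        · rw [if_pos hc, if_pos ⟨i, ha, hc⟩]
        · rw [if_neg hc, if_neg]
          rintro ⟨i', hi', hc'⟩
          have e : i' = i := hu (hi'.trans ha.symm)
          rw [e] at hc'
          exact hc hc'
      simp_rw [hxa]
      by_cases hsub : δ j ⊆ δ (τ i)
      · rw [if_pos hsub, Finset.prod_eq_one fun c hc => by rw [if_pos (hsub hc)], mul_one]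
      · rw [if_neg hsub]
        obtain ⟨c, hc, hc'⟩ := Finset.not_subset.mp hsub
        rw [Finset.prod_eq_zero hc (by rw [if_neg hc']), mul_zero]
  -- the evaluated matrix is a row permutation of a containment-triangular matrix
  have hmat : (MvPolynomial.eval x).mapMatrix (Matrix.of fun i j => Θ (u i) (δ j)) =
      (Matrix.of fun j' j : ι => if δ j ⊆ δ j' then (-1 : ℂ) ^ (δ j).card * ((δ j).card.factorial : ℂ)
        else 0).submatrix τ id := by
    ext i j
    rw [RingHom.mapMatrix_apply, Matrix.map_apply, Matrix.of_apply, hentry, Matrix.submatrix_apply,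
      Matrix.of_apply, id]
  rw [hmat, Matrix.det_permute, det_of_subsetTriangular δ hδ _ (fun i j hij => ?_)] at hev
  · refine mul_ne_zero (by simp) (Finset.prod_ne_zero_iff.mpr fun j _ => ?_) hev
    rw [Matrix.of_apply, if_pos (Finset.Subset.refl _)]
    exact mul_ne_zero (pow_ne_zero _ (by norm_num)) (by exact_mod_cast (δ j).card.factorial_ne_zero)
  · by_contra hsub
    rw [Matrix.of_apply, if_neg hsub] at hij
    exact hij rfl

end Summit.ValiantsHypothesis.ValiantsHypothesis.Theorems.BarrierLever.ChowCube
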